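import Summits.CriticalPhenomena.CardyFormulaZ2.Theses.DyadicBetaRigidity

/-!
# Route DyadicBetaRigidity — assembly item (stmt-CriticalPhenomena-18185)

The assembly item `Assembly` of route `DyadicBetaRigidity` is the curried form of the route's
deciding theorem `closes`:
`DyadicLatticeBetaLaw → CardyRigidity → DyadicBetaSuffices → CardyFormulaZ2`.
Obtain the exponent `a` from `DyadicLatticeBetaLaw`, apply the glue `DyadicBetaSuffices` to get the
crossing law `I_a` for every conformal rectangle, identify `I_a = cardyFunction` on `(0,1)` by
`CardyRigidity`, and evaluate at the cross-ratio of the uniformizing datum (which lies in `(0,1)`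
by `ConformalRectangle.crossRatio_mem_Ioo_of_isUniformizing`).
-/

namespace Summit.CriticalPhenomena.CardyFormulaZ2.Theorems.DyadicBetaRigidity

open Summit.CriticalPhenomena.CardyFormulaZ2.Theses.DyadicBetaRigidity

/-- The assembly of route `DyadicBetaRigidity` (item stmt-CriticalPhenomena-18185): the dyadic
lattice beta law, Cardy rigidity and the dyadic-suffices glue together give Cardy's formula for
critical bond percolation on `ℤ²`. This is exactly the route's deciding theorem `closes`,
curried. -/
theorem assembly_proof :
    Summit.CriticalPhenomena.CardyFormulaZ2.Theses.DyadicBetaRigidity.Assembly := by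
  unfold Summit.CriticalPhenomena.CardyFormulaZ2.Theses.DyadicBetaRigidity.Assembly
  intro hLaw hRig hSuff
  exact Summit.CriticalPhenomena.CardyFormulaZ2.Theses.DyadicBetaRigidity.closes hLaw hRig hSuff

/-- Self-contained variant of `assembly_proof` that does not go through the route file's `closes`
theorem: the same three-step argument spelled out (exponent from the beta law, glue to all
conformal rectangles and all meshes, rigidity on `(0,1)` at the cross-ratio of the uniformizing
datum). -/
theorem assembly_proof' :
    Summit.CriticalPhenomena.CardyFormulaZ2.Theses.DyadicBetaRigidity.Assembly := by
  unfold Summit.CriticalPhenomena.CardyFormulaZ2.Theses.DyadicBetaRigidity.Assembly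
  intro hLaw hRig hSuff
  obtain ⟨a, ha, hD⟩ := hLaw
  have hall := hSuff a ha hD
  have hEq := hRig _ hall
  intro R φ x hφ
  have hη : Literature.Probability.RandomPlanarGeometry.crossRatio x ∈ Set.Ioo (0 : ℝ) 1 :=
    Literature.Probability.RandomPlanarGeometry.ConformalRectangle.crossRatio_mem_Ioo_of_isUniformizing
      hφ
  show Filter.Tendsto _ _ _
  rw [← hEq hη]
  exact hall R φ x hφ

end Summit.CriticalPhenomena.CardyFormulaZ2.Theorems.DyadicBetaRigidity
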